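import Summits.QuantumFields.YangMills.Theorems.BalabanUVNodesN07AtRecordTwoTier
import Summits.QuantumFields.YangMills.Theorems.BalabanUVNodesN07RestrictionLawAtObjects
import Summits.QuantumFields.YangMills.Theorems.BalabanUVNodesN07SectAObjects
import Literature.MathematicalPhysics.QuantumFieldTheory.Balaban1983to89.B11Thm1TwoTierOneSided

/-!
# BalabanUVNodes ∕ N07 ([B11]) — THE REPAIRED-TOWER CURRENCY AT THE ₁₁ RECORD WITHOUT THE LOCAL-MINIMUM LAW: seat -d's tower of record
# (`BalabanUVNodesN07AtRecordTwoTier`, p455032) re-run on the ONE-SIDED dictionary (`B11Thm1TwoTierOneSided`) — Theorem 1 at every member of the family of record,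
# the background-free Proposition 7, the [B11] leaf at `Z11OfRecord F N ζ` and N07 at the ₁₁ carrier record from Props 2, 5, 6, 8, Sect. F, the bridges and `hcrit` ONLY

Track A of `YM-PLAN.md` (cell `pub-ymgap`, HUMAN RULING D-0062), node **N07** = [Balaban1985Variational] Thm 1 p. 279 + Props 2–9 pp. 281–309; seat `pub-ymgap-dag-n07-e`
(generation 0; `FAN-OUT.md` v1.1 §N07 row s3 REPAIRED-TOWER CURRENCY), fourth module, finding F-n07e-1 carried to the tower currency.  THEOREMS ONLY (0 `def`, 0 `sorry`,
standard axioms); COUNT-NEUTRAL; `--supports stmt-QuantumFields-19674`.  Imports seat -d's `BalabanUVNodesN07AtRecordTwoTier` (p455032: `eps_pos_of_plaqSmall`,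
`inUkClassB11_succ_of_inUkClassB11`, `exists_record₁₁CB10YZW_b11_main_of_leaf`), this seat's `BalabanUVNodesN07RestrictionLawAtObjects` (p456450: `onMinimalOrbit_restrict_of_le`,
`reg7_mono_record`), `BalabanUVNodesN07SectAObjects` (p454423: `expMeanLogSU_E_const_one`) and `B11Thm1TwoTierOneSided` (p458026, the one-sided induction); nothing modified.

T. Bałaban, *The variational problem and background fields in renormalization group method for lattice gauge theories*, Commun. Math. Phys. **102** (1985) 277–309
[Balaban1985Variational]; p. 304 [pdf 28]: *«Especially it implies that U_k is in the space (8).»* (the one use of the restriction law, at `e = B₃ε₁ ≤ e′ = O(1)C₁B₃ε₁`).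

WHAT CHANGES RELATIVE TO p455032.  Seat -d's §3 builds the repaired scale tower `B11Thm1TwoTier.TowerT` AT NODE 00's OBJECTS (members `famXOfRecord F N ζ ⟨K, n, _⟩` with `Near :=` the
carrier's own (3), `V0 := BlockAveragingSection.faceSec`, `RegT := PlaqSmall (κ₀ε)`, `lift = base = id`), proves its class laws and Sect.-A leaves there, and feeds
`B11LeafKnitTwoTier.thm1TAt_towerT_of_parts ∕ prop7Printed_towerT_of_parts` with the dictionary binder `lawsA := laws_famXOfRecord ζ _ (hcrit _) (hloc _)` — so its theorems
display `hloc`, the local-minimum half of `B11.VarProblemX.Laws` (iii) (D-B11-2).  Here the SAME tower (re-typed verbatim — adapted from p455032 §3, credited) is fed to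
`B11Thm1TwoTierOneSided.thm1TAt_towerT_of_parts_oneSided ∕ prop7Printed_towerT_of_parts_oneSided`, whose dictionary asks (iii) only for `e ≤ e′` — a THEOREM at objects
(`onMinimalOrbit_restrict_of_le`) — plus the monotonicity of (7) (`reg7_mono_record`); laws (ii), (iv) come from `hcrit` exactly as in `laws_famXOfRecord`.  Result: the
four theorems of p455032 §3–§4 WITHOUT `hloc` (`_noLoc`), everything else displayed unchanged.

* §1 `thm1At_prop7_famOfRecord_of_towerT_parts_noLoc` — ONE block of constants (`B₃″ = κ₀B₃`) with `Thm1At` at every member of `famVOfRecord F N ζ` ∧ the background-free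
  `Prop7Printed (B₃κ₀) ζ.C₁ (famXOfRecord F N ζ)`, from Props 2, 5, 6 over `ζ.famLG` (bridges `β ∕ bg ∕ hbg14`, `Bridge.Laws`, `ExistenceLeavesCap`), Prop 8 + Sect. F over
  `famXOfRecord F N ζ` at `B₃`, `hcrit`, the printed constant relations — NO `hloc`.
* §2 `b11Leaf_Z11OfRecord_of_towerT_parts_noLoc`, `exists_record₁₁CB10YZW_b11_main_of_towerT_parts_noLoc` (the leaf at the bundle of record with `ζ.B₃ = B₃κ₀` and N07 at the
  ₁₁ carrier record), `b11Leaf_Z11OfRecord_of_towerT_parts_kappa_one_noLoc` (κ₀ = 1: the printed tower at the torus of record, every statement at ONE constant).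

HONEST FRAMING.  Kernel bookkeeping; after p456450 (print's Prop-7 DAG) the REPAIRED-TOWER currency is now also free of `hloc` — N07's displayed non-printed dictionary residual
is `hcrit` alone in BOTH currencies; nothing added; NOTHING of Sects. B–G proved; [B11] Theorem 1 for `k ≥ 1` is DERIVED here only from the displayed Props 2, 5, 6, 8,
Sect. F + bridges; N07 NOT discharged; counts 5∕27 unmoved; no object of record modified; one finite four-torus programme at fixed `ε` — NOT continuum ∕ ℝ⁴ ∕ infinite
volume ∕ OS ∕ mass gap ∕ Clay.  No `def`, no `instance`, no `notation`.
-/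

noncomputable section

namespace Summit.QuantumFields.YangMills.BalabanUVNodes.N07AtRecordTwoTierOneSided

open Literature.MathematicalPhysics.QuantumFieldTheory.Balaban1983to89
open Literature.MathematicalPhysics.QuantumFieldTheory.Balaban1983to89.T4Continuum (T4Family FiniteEpsData)
open Literature.MathematicalPhysics.QuantumFieldTheory.Balaban1983to89.DagBinding
open Literature.MathematicalPhysics.QuantumFieldTheory.Balaban1983to89.Node00
open Literature.MathematicalPhysics.QuantumFieldTheory.Balaban1983to89.B11Thm1 (Thm1At)
open Literature.MathematicalPhysics.QuantumFieldTheory.Balaban1983to89.B11Thm1TwoTier (TowerT)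
open Literature.MathematicalPhysics.QuantumFieldTheory.Balaban1983to89.B11Thm1CarrierT (RegCarrierT varProblemT)
open Literature.MathematicalPhysics.QuantumFieldTheory.Balaban1983to89.B11Prop7Assembly (Bridge ExistenceLeavesCap)
open Literature.MathematicalPhysics.QuantumFieldTheory.Balaban1983to89.BlockAveragingSection (faceSec blockAvg_faceSec)
open Literature.MathematicalPhysics.QuantumFieldTheory.Balaban1983to89.BlockAveragingSectionPlaq (plaqSmall_faceSec)
open Literature.MathematicalPhysics.QuantumFieldTheory.Balaban1983to89.ExpMeanLog (expMeanLogSU)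
open Literature.MathematicalPhysics.QuantumFieldTheory.Balaban1983to89.B11Thm1TwoTierOneSided
  (thm1TAt_towerT_of_parts_oneSided prop7Printed_towerT_of_parts_oneSided)
open Summit.QuantumFields.YangMills.BalabanUVNodes.N07AtRecordTwoTier
  (eps_pos_of_plaqSmall inUkClassB11_succ_of_inUkClassB11 exists_record₁₁CB10YZW_b11_main_of_leaf)
open Summit.QuantumFields.YangMills.BalabanUVNodes.N07RestrictionLawAtObjects (onMinimalOrbit_restrict_of_le reg7_mono_record)
open Summit.QuantumFields.YangMills.BalabanUVNodes.N07SectAObjects (expMeanLogSU_E_const_one)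
open scoped Matrix.Norms.L2Operator

variable {N : ℕ} [NeZero N]

/-! ## §1 Theorem 1 over the family of record and the background-free Proposition 7 by the repaired induction, one-sided dictionary -/

section Tower

/-! The DISPLAYED inputs of this section — seat -d's list MINUS `hloc`, written as explicit binders of each theorem: the residual [B11] layer `ζ`, the bridges `β`, `bg`
with `hbg14`, `Bridge.Laws`, `ExistenceLeavesCap` ((15)–(18) p. 280, (112)–(142) pp. 294–299), the dictionary residual `hcrit` («minimal ⇒ critical» for `ζ.IsCrit`), the
printed constant relations, Props 2, 5, 6 over `ζ.famLG` and Prop 8, Sect. F over `famXOfRecord F N ζ` at the Sect.-F constant `B₃`. -/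
variable {F : T4Family}

/-- **THEOREM 1 AT EVERY MEMBER OF THE FAMILY OF RECORD WITH ONE BLOCK OF CONSTANTS (`B₃″ = κ₀B₃`) AND THE BACKGROUND-FREE PROPOSITION 7 OVER `famXOfRecord F N ζ` AT
`(B₃κ₀, C₁)`, BY THE REPAIRED SECT.-A INDUCTION ON THE TOWER OF RECORD — WITHOUT `hloc`.**  The tower literal, its class laws and its Sect.-A leaves are seat -d's (p455032
§3, adapted verbatim: members `famXOfRecord`, `V₀ := faceSec`, (7″) = (7)[κ₀ε₁], `StepA11T` by `plaqSmall_faceSec`, `StepA13T` by `inUkClassB11_succ_of_inUkClassB11` +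
`blockAvg_faceSec`, `BaseK1T` by `B11Thm1LevelZero`); the induction is `B11Thm1TwoTierOneSided.thm1TAt_towerT_of_parts_oneSided ∕ prop7Printed_towerT_of_parts_oneSided`,
whose dictionary — (i) monotonicity of (2), (ii) «minimal ⇒ critical ∧ in the space» from `hcrit`, (iii′) restriction for `e ≤ e′` = `onMinimalOrbit_restrict_of_le`, (iv)
from `hcrit`, (7) monotone = `reg7_mono_record` — is a THEOREM at objects modulo `hcrit`. [cite: Balaban1985Variational, Thm 1 p.279, Sect. A (11)–(14) pp.279–280, Prop. 7 p.299, Prop. 8 p.304, p.304 («Especially it implies that U_k is in the space (8)»), Sect. F (169) p.305] -/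
theorem thm1At_prop7_famOfRecord_of_towerT_parts_noLoc (ζ : ResidZ F N)
    (β : ∀ i : ZIdx, Bridge (famXOfRecord F N ζ i) (ζ.famLG i)) (bg : ∀ i : ZIdx, GaugeField (F.P i.K) 0 (SU N) → (ζ.famLG i).Cfg)
    {κ₀ B₃ O₁ O₂ e₅ : ℝ}
    (hbg14 : ∀ (i : ZIdx) (ε : ℝ) (V : GaugeField (F.P i.K) i.k (SU N)) (U : GaugeField (F.P i.K) 0 (SU N)),
      InUkClassB11 F N i.K i.k (ζ.C₁ * B₃ * ε) U → Averaging.iter (avOfRecord F N i.K) i.k U = V →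
        (ζ.famLG i).Sat14 (ζ.C₁ * B₃ * ε) (ζ.C₁ * ε) ((β i).bdry V) (bg i U))
    (laws : ∀ i, (β i).Laws ζ.C₁ B₃) (leaves : ∀ i, ExistenceLeavesCap (β i) ζ.B₀ B₃ ζ.C₁ O₁ O₂ e₅)
    (hcrit : ∀ (i : ZIdx) (e : ℝ) (V : GaugeField (F.P i.K) i.k (SU N)) (U : GaugeField (F.P i.K) 0 (SU N)),
      IsBackground (avOfRecord F N i.K) {U | InUkClassB11 F N i.K i.k e U} i.k V U → ζ.IsCrit i V U)
    (hκ₀ : 1 ≤ κ₀) (hB₀ : 0 < ζ.B₀) (hB₁ : 0 < ζ.B₁) (hB₃ : 1 ≤ B₃) (hC₁L : (F.L : ℝ) ^ 3 ≤ ζ.C₁) (hB₀B₁ : ζ.B₀ ≤ 4 * ζ.B₁)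
    (hc₁ : 0 < ζ.c₁) (hO₁ : 0 < O₁) (hO₂ : 0 < O₂) (he₅ : 0 < e₅)
    (p2 : B11.Prop2Printed ζ.B₁ B₃ ζ.C₁ ζ.c₁ ζ.famLG) (p5 : B11.Prop5Printed ζ.B₁ B₃ ζ.C₁ ζ.famLG) (p6 : B11.Prop6Printed ζ.B₀ B₃ ζ.C₁ ζ.famLG)
    (p8 : B11.Prop8Printed B₃ (famXOfRecord F N ζ)) (sF : B11.SectFPrinted B₃ (famXOfRecord F N ζ)) :
    (∃ C : B11Thm1.Consts, C.B₃ = B₃ * κ₀ ∧ ∀ i : ZIdx, Thm1At C (varProblemT F N i.K i.k (ζ.R i))) ∧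
      B11.Prop7Printed (B₃ * κ₀) ζ.C₁ (famXOfRecord F N ζ) := by
  -- THE TOWER OF RECORD — adapted from seat -d's `BalabanUVNodesN07AtRecordTwoTier.thm1At_prop7_famOfRecord_of_towerT_parts` (p455032 §3)
  let T : TowerT :=
    { I := fun n => {K : ℕ // n ≤ K}
      fam := fun n i => ⟨famXOfRecord F N ζ ⟨i.1, n, i.2⟩, fun _ V U => (famXOfRecord F N ζ ⟨i.1, n, i.2⟩).InB V U⟩
      L := (F.L : ℝ)
      drop := fun n i => ⟨i.1, (Nat.le_succ n).trans i.2⟩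
      V0 := fun _ _ V => faceSec V
      lift := fun _ _ U => U
      base := fun _ V => V
      κ₀ := κ₀
      C₁' := 0
      RegT := fun _ _ ε V => PlaqSmall (κ₀ * ε) V
      V0c := fun _ _ V => faceSec V }
  let e : (Σ n, T.I n) → ZIdx := fun p => ⟨p.2.1, p.1, p.2.2⟩
  have hκ₀pos : 0 < κ₀ := lt_of_lt_of_le one_pos hκ₀
  have hL1 : (1 : ℝ) ≤ T.L := by
    show (1 : ℝ) ≤ (F.L : ℝ)
    exact_mod_cast (F.P 0).L_pos
  have hL3_7 : (7 : ℝ) ≤ (F.L : ℝ) ^ 3 := by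
    have h2 : (2 : ℝ) ≤ (F.L : ℝ) := by exact_mod_cast (F.P 0).hL.2
    nlinarith [h2, mul_le_mul h2 h2 (by norm_num) (by linarith)]
  have h7C : 7 ≤ ζ.C₁ * B₃ := by nlinarith
  have hrange : ∀ (n : ℕ) (i : T.I (n + 1)), n + 1 ≤ (F.P i.1).m + (F.P i.1).K := fun n i => by
    have hi : n + 1 ≤ i.1 := i.2
    rw [T4Family.P_m, T4Family.P_K]
    omega
  haveI : Nonempty (Fin N) := ⟨⟨0, Nat.pos_of_ne_zero (NeZero.ne N)⟩⟩
  -- the class laws of (7″) at the torus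
  have cl : T.ClassLaws := by
    refine ⟨hκ₀, le_rfl, fun n i ε V hV => ?_, fun n i ε V hV => hV, fun n i b b' V U _ h => h⟩
    show PlaqSmall (κ₀ * ε) V
    have hε : 0 < ε := eps_pos_of_plaqSmall hV
    exact fun p => (hV p).trans_le (le_mul_of_one_le_left hε.le hκ₀)
  -- THE ONE-SIDED DICTIONARY AT EVERY MEMBER — theorems at objects modulo `hcrit`; NO `hloc`
  have mono : ∀ (n : ℕ) (i : T.I n) (e₁ e₂ : ℝ) (U : (T.fam n i).Cfg), e₁ ≤ e₂ → (T.fam n i).InU e₁ U → (T.fam n i).InU e₂ U :=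
    fun n i e₁ e₂ U hle hU => B11Thm1CarrierTLevelZero.inUkClassB11_mono hle hU
  have minlaw : ∀ (n : ℕ) (i : T.I n) (e₁ : ℝ) (V : (T.fam n i).Bdry) (U : (T.fam n i).Cfg),
      (T.fam n i).OnMinimalOrbit e₁ V U → (T.fam n i).IsCritical V U ∧ (T.fam n i).InU e₁ U ∧ (T.fam n i).InB V U :=
    fun n i e₁ V U hU => ⟨hcrit ⟨i.1, n, i.2⟩ e₁ V U hU, hU.2.1, hU.1⟩
  have restr : ∀ (n : ℕ) (i : T.I n) (e₁ e₂ : ℝ) (V : (T.fam n i).Bdry) (U : (T.fam n i).Cfg), e₁ ≤ e₂ →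
      (T.fam n i).OnMinimalOrbit e₂ V U → (T.fam n i).InU e₁ U → (T.fam n i).OnMinimalOrbit e₁ V U :=
    fun n i e₁ e₂ V U hle h hIn => onMinimalOrbit_restrict_of_le (ζ.R ⟨i.1, n, i.2⟩) hle h hIn
  have uniq : ∀ (n : ℕ) (i : T.I n) (ε₀ : ℝ) (V : (T.fam n i).Bdry) (U : (T.fam n i).Cfg), (T.fam n i).InU ε₀ U → (T.fam n i).InB V U →
      (T.fam n i).IsCritical V U →
        (∀ U' : (T.fam n i).Cfg, (T.fam n i).InU ε₀ U' → (T.fam n i).InB V U' → (T.fam n i).IsCritical V U' → (T.fam n i).SameOrbit U' U) →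
          (T.fam n i).UniqueCriticalOrbit ε₀ V U :=
    fun n i ε₀ V U hIn hB _ hall => ⟨hIn, hB, fun U' hU' => (hall U' hU'.2.1 hU'.1 (hcrit ⟨i.1, n, i.2⟩ ε₀ V U' hU')).symm⟩
  have mono7 : ∀ (n : ℕ) (i : T.I n) (ε ε' : ℝ) (V : (T.fam n i).Bdry), ε ≤ ε' → (T.fam n i).Reg7 ε V → (T.fam n i).Reg7 ε' V :=
    fun n i ε ε' V hle h => reg7_mono_record (ζ.R ⟨i.1, n, i.2⟩) hle h
  -- the Sect.-A leaves at objects (as in p455032): (11a), (13) + (11b), k = 0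
  have hA11 : B11Thm1TwoTier.StepA11T T := fun n i ε₁ V hV =>
    plaqSmall_faceSec (hrange n i) (eps_pos_of_plaqSmall hV) hV
  have hA13 : B11Thm1TwoTier.StepA13T T := by
    intro n i ε₁ e₀ V U _ hU hB
    refine ⟨inUkClassB11_succ_of_inUkClassB11 hU, ?_⟩
    show (avOfRecord F N i.1 n).avg (Averaging.iter (avOfRecord F N i.1) n U) = V
    have hB' : Averaging.iter (avOfRecord F N i.1) n U = faceSec V := hB
    rw [hB', avOfRecord_apply]
    exact blockAvg_faceSec (hrange n i) expMeanLogSU expMeanLogSU_E_const_one V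
  have hK1 : B11Thm1TwoTier.BaseK1T T B₃ ζ.C₁ := by
    intro i ε₁ V hε₁ hV
    refine ⟨?_, rfl⟩
    show InUkClassB11 F N i.1 0 (ζ.C₁ * B₃ * (κ₀ * ε₁)) V
    have hV' : InUkClassB11 F N i.1 0 (7 * (κ₀ * ε₁)) V :=
      B11Thm1LevelZero.inUkClassB11_zero_of_plaqSmall F N i.1 (mul_pos hκ₀pos hε₁) hV
    exact B11Thm1CarrierTLevelZero.inUkClassB11_mono (mul_le_mul_of_nonneg_right h7C (mul_pos hκ₀pos hε₁).le) hV'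
  -- the bridge data and the printed parts re-indexed on the tower (as in p455032)
  have hbg14' : ∀ (p : Σ n, T.I n) (ε : ℝ) (V : (T.fam p.1 p.2).Bdry) (U : (T.fam p.1 p.2).Cfg),
      (T.fam p.1 p.2).Sat14 ζ.C₁ B₃ ε V U →
        (ζ.famLG (e p)).Sat14 (ζ.C₁ * B₃ * ε) (ζ.C₁ * ε) ((β (e p)).bdry V) (bg (e p) U) :=
    fun p ε V U h14 => hbg14 (e p) ε V U h14.1 h14.2
  have p2' : B11.Prop2Printed ζ.B₁ B₃ ζ.C₁ ζ.c₁ (fun p : Σ n, T.I n => ζ.famLG (e p)) := fun p => p2 (e p)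
  have p5' : B11.Prop5Printed ζ.B₁ B₃ ζ.C₁ (fun p : Σ n, T.I n => ζ.famLG (e p)) := by
    obtain ⟨c, hc, H⟩ := p5
    exact ⟨c, hc, fun p => H (e p)⟩
  have p6' : B11.Prop6Printed ζ.B₀ B₃ ζ.C₁ (fun p : Σ n, T.I n => ζ.famLG (e p)) := by
    obtain ⟨a₄, ha₄, H⟩ := p6
    exact ⟨a₄, ha₄, fun p => H (e p)⟩
  have p8' : B11.Prop8Printed B₃ T.famAllX := by
    obtain ⟨a₅, ha₅, H⟩ := p8
    exact ⟨a₅, ha₅, fun p => H (e p)⟩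
  have sF' : B11.SectFPrinted B₃ T.famAllX := by
    obtain ⟨a₁, B₄, RM, ha₁, hB₄, hRM, H⟩ := sF
    exact ⟨a₁, B₄, RM, ha₁, hB₄, hRM, fun p => H (e p)⟩
  have hC₁' : T.C₁' ≤ ζ.C₁ := le_trans (le_refl (0 : ℝ)) (by linarith [one_le_pow₀ (M₀ := ℝ) (n := 3) hL1])
  refine ⟨?_, ?_⟩
  · obtain ⟨C, hCB, H⟩ := thm1TAt_towerT_of_parts_oneSided T mono minlaw restr uniq mono7 (fun p => ζ.famLG (e p)) (fun p => β (e p))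
      (fun p U => bg (e p) U) hbg14' (fun p => laws (e p)) (fun p => leaves (e p)) cl hA11 hA13 hK1 hB₀ hB₁ hB₃ hL1 hC₁L
      hC₁' hB₀B₁ hc₁ hO₁ hO₂ he₅ p2' p5' p6' p8' sF'
    exact ⟨C, hCB, fun i => B11Thm1TwoTier.thm1At_of_thm1TAt T C cl i.k ⟨i.K, i.hk⟩ (H i.k ⟨i.K, i.hk⟩)⟩
  · obtain ⟨a₀, a₁', O, ha₀, ha₁', hO, H⟩ := prop7Printed_towerT_of_parts_oneSided T mono minlaw restr uniq mono7 (fun p => ζ.famLG (e p))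
      (fun p => β (e p)) (fun p U => bg (e p) U) hbg14' (fun p => laws (e p)) (fun p => leaves (e p)) cl hA11 hA13 hK1 hB₀ hB₁
      hB₃ hL1 hC₁L hC₁' hB₀B₁ hc₁ hO₁ hO₂ he₅ p2' p5' p6' p8' sF'
    exact ⟨a₀, a₁', O, ha₀, ha₁', hO, fun i => H ⟨i.k, ⟨i.K, i.hk⟩⟩⟩

/-! ## §2 The [B11] leaf at the bundle of record and N07 at the ₁₁ carrier record, repaired-tower currency, without `hloc` -/

/-- **THE [B11] LEAF AT `Z11OfRecord F N ζ` FROM THE TOWER PARTS, WITHOUT `hloc`** (`ζ.B₃ = B₃κ₀`): `t1` and `p7` DERIVED by the one-sided repaired induction (§1); the leaf's own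
Props 2, 3, 4, 5, 6, 8, Sect. F at `ζ.B₃` and Prop 9 enter verbatim — seat -d's `b11Leaf_Z11OfRecord_of_towerT_parts` minus `hloc`. [cite: Balaban1985Variational, Thm 1 p.279, Props 2–9 pp.281–309, Sect. A pp.279–280] -/
theorem b11Leaf_Z11OfRecord_of_towerT_parts_noLoc (ζ : ResidZ F N)
    (β : ∀ i : ZIdx, Bridge (famXOfRecord F N ζ i) (ζ.famLG i)) (bg : ∀ i : ZIdx, GaugeField (F.P i.K) 0 (SU N) → (ζ.famLG i).Cfg)
    {κ₀ B₃ O₁ O₂ e₅ : ℝ}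
    (hbg14 : ∀ (i : ZIdx) (ε : ℝ) (V : GaugeField (F.P i.K) i.k (SU N)) (U : GaugeField (F.P i.K) 0 (SU N)),
      InUkClassB11 F N i.K i.k (ζ.C₁ * B₃ * ε) U → Averaging.iter (avOfRecord F N i.K) i.k U = V →
        (ζ.famLG i).Sat14 (ζ.C₁ * B₃ * ε) (ζ.C₁ * ε) ((β i).bdry V) (bg i U))
    (laws : ∀ i, (β i).Laws ζ.C₁ B₃) (leaves : ∀ i, ExistenceLeavesCap (β i) ζ.B₀ B₃ ζ.C₁ O₁ O₂ e₅)
    (hcrit : ∀ (i : ZIdx) (e : ℝ) (V : GaugeField (F.P i.K) i.k (SU N)) (U : GaugeField (F.P i.K) 0 (SU N)),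
      IsBackground (avOfRecord F N i.K) {U | InUkClassB11 F N i.K i.k e U} i.k V U → ζ.IsCrit i V U)
    (hκ₀ : 1 ≤ κ₀) (hB₀ : 0 < ζ.B₀) (hB₁ : 0 < ζ.B₁) (hB₃ : 1 ≤ B₃) (hC₁L : (F.L : ℝ) ^ 3 ≤ ζ.C₁) (hB₀B₁ : ζ.B₀ ≤ 4 * ζ.B₁)
    (hc₁ : 0 < ζ.c₁) (hO₁ : 0 < O₁) (hO₂ : 0 < O₂) (he₅ : 0 < e₅)
    (p2 : B11.Prop2Printed ζ.B₁ B₃ ζ.C₁ ζ.c₁ ζ.famLG) (p5 : B11.Prop5Printed ζ.B₁ B₃ ζ.C₁ ζ.famLG) (p6 : B11.Prop6Printed ζ.B₀ B₃ ζ.C₁ ζ.famLG)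
    (p8 : B11.Prop8Printed B₃ (famXOfRecord F N ζ)) (sF : B11.SectFPrinted B₃ (famXOfRecord F N ζ)) (hζ : ζ.B₃ = B₃ * κ₀)
    (q2 : B11.Prop2Printed ζ.B₁ ζ.B₃ ζ.C₁ ζ.c₁ ζ.famLG) (q3 : B11.Prop3Printed ζ.C₁ ζ.B₃ ζ.C₂ ζ.C₃ ζ.B₀ ζ.c1h ζ.c₄ ζ.δ₀ ζ.famLG)
    (q4 : B11.Prop4Printed ζ.C₁ ζ.B₃ ζ.famLG) (q5 : B11.Prop5Printed ζ.B₁ ζ.B₃ ζ.C₁ ζ.famLG) (q6 : B11.Prop6Printed ζ.B₀ ζ.B₃ ζ.C₁ ζ.famLG)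
    (q8 : B11.Prop8Printed ζ.B₃ (famXOfRecord F N ζ)) (qF : B11.SectFPrinted ζ.B₃ (famXOfRecord F N ζ))
    (p9 : B11.Prop9Printed ζ.B₅ ζ.C₁ ζ.β₀ ζ.δ₀ ζ.famAn) :
    B11Leaf (Z11OfRecord F N ζ) := by
  obtain ⟨⟨C, -, H⟩, h7⟩ := thm1At_prop7_famOfRecord_of_towerT_parts_noLoc ζ β bg hbg14 laws leaves hcrit hκ₀ hB₀ hB₁ hB₃ hC₁L hB₀B₁ hc₁ hO₁
    hO₂ he₅ p2 p5 p6 p8 sF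
  refine ⟨(B11Thm1CarrierT.thm1Printed_iff_thm1At (fun i : ZIdx => i.K) (fun i => i.k) ζ.R).2 ⟨C, H⟩, q2, q3, q4, q5, q6, ?_, q8, qF, p9⟩
  show B11.Prop7Printed ζ.B₃ ζ.C₁ (famXOfRecord F N ζ)
  rw [hζ]
  exact h7

/-- **N07 AT THE ₁₁ CARRIER RECORD FROM THE TOWER PARTS, WITHOUT `hloc`** (seat -d's `exists_record₁₁CB10YZW_b11_main_of_towerT_parts` minus `hloc`, through their ∃-direction
`exists_record₁₁CB10YZW_b11_main_of_leaf`; junk in-edges, NOT a discharge). [cite: Balaban1985Variational, Thm 1 p.279, Props 2–9 pp.281–309, Sect. A pp.279–280] -/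
theorem exists_record₁₁CB10YZW_b11_main_of_towerT_parts_noLoc (ζ : ResidZ F N)
    (β : ∀ i : ZIdx, Bridge (famXOfRecord F N ζ i) (ζ.famLG i)) (bg : ∀ i : ZIdx, GaugeField (F.P i.K) 0 (SU N) → (ζ.famLG i).Cfg)
    {κ₀ B₃ O₁ O₂ e₅ : ℝ}
    (hbg14 : ∀ (i : ZIdx) (ε : ℝ) (V : GaugeField (F.P i.K) i.k (SU N)) (U : GaugeField (F.P i.K) 0 (SU N)),
      InUkClassB11 F N i.K i.k (ζ.C₁ * B₃ * ε) U → Averaging.iter (avOfRecord F N i.K) i.k U = V →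
        (ζ.famLG i).Sat14 (ζ.C₁ * B₃ * ε) (ζ.C₁ * ε) ((β i).bdry V) (bg i U))
    (laws : ∀ i, (β i).Laws ζ.C₁ B₃) (leaves : ∀ i, ExistenceLeavesCap (β i) ζ.B₀ B₃ ζ.C₁ O₁ O₂ e₅)
    (hcrit : ∀ (i : ZIdx) (e : ℝ) (V : GaugeField (F.P i.K) i.k (SU N)) (U : GaugeField (F.P i.K) 0 (SU N)),
      IsBackground (avOfRecord F N i.K) {U | InUkClassB11 F N i.K i.k e U} i.k V U → ζ.IsCrit i V U)
    (hκ₀ : 1 ≤ κ₀) (hB₀ : 0 < ζ.B₀) (hB₁ : 0 < ζ.B₁) (hB₃ : 1 ≤ B₃) (hC₁L : (F.L : ℝ) ^ 3 ≤ ζ.C₁) (hB₀B₁ : ζ.B₀ ≤ 4 * ζ.B₁)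
    (hc₁ : 0 < ζ.c₁) (hO₁ : 0 < O₁) (hO₂ : 0 < O₂) (he₅ : 0 < e₅)
    (p2 : B11.Prop2Printed ζ.B₁ B₃ ζ.C₁ ζ.c₁ ζ.famLG) (p5 : B11.Prop5Printed ζ.B₁ B₃ ζ.C₁ ζ.famLG) (p6 : B11.Prop6Printed ζ.B₀ B₃ ζ.C₁ ζ.famLG)
    (p8 : B11.Prop8Printed B₃ (famXOfRecord F N ζ)) (sF : B11.SectFPrinted B₃ (famXOfRecord F N ζ))
    (hζ : ζ.B₃ = B₃ * κ₀) (θ : Stage11Params F N) (h : θ.Provisos₁₁) (hθ : θ.Admissible)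
    (hγ : 0 < θ.γ) (Mstar : ℕ) (ops : OpsY N θ.toStage3Params Mstar) (lamW : ResidW F N)
    (q2 : B11.Prop2Printed ζ.B₁ ζ.B₃ ζ.C₁ ζ.c₁ ζ.famLG) (q3 : B11.Prop3Printed ζ.C₁ ζ.B₃ ζ.C₂ ζ.C₃ ζ.B₀ ζ.c1h ζ.c₄ ζ.δ₀ ζ.famLG)
    (q4 : B11.Prop4Printed ζ.C₁ ζ.B₃ ζ.famLG) (q5 : B11.Prop5Printed ζ.B₁ ζ.B₃ ζ.C₁ ζ.famLG) (q6 : B11.Prop6Printed ζ.B₀ ζ.B₃ ζ.C₁ ζ.famLG)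
    (q8 : B11.Prop8Printed ζ.B₃ (famXOfRecord F N ζ)) (qF : B11.SectFPrinted ζ.B₃ (famXOfRecord F N ζ))
    (p9 : B11.Prop9Printed ζ.B₅ ζ.C₁ ζ.β₀ ζ.δ₀ ζ.famAn) :
    ∃ w : WorldP, IsRecordOfRecord₁₁CB10YZW F N (datumOfRecord₁₁ F N θ h) w ∧ ∀ P : B12.RunParams, Dag.B11_main (leavesP w P) :=
  exists_record₁₁CB10YZW_b11_main_of_leaf θ h hθ hγ Mstar ops ζ lamW
    (b11Leaf_Z11OfRecord_of_towerT_parts_noLoc ζ β bg hbg14 laws leaves hcrit hκ₀ hB₀ hB₁ hB₃ hC₁L hB₀B₁ hc₁ hO₁ hO₂ he₅ p2 p5 p6 p8 sF hζ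
      q2 q3 q4 q5 q6 q8 qF p9)

end Tower

/-! ## §3 κ₀ = 1: the printed tower at the torus of record, ONE constant, without `hloc` -/

section KappaOne
variable {F : T4Family}

/-- **THE PRINTED TOWER AT THE TORUS OF RECORD (κ₀ = 1), WITHOUT `hloc`**: the [B11] leaf at the bundle of record with EVERY printed statement at the ONE constant `ζ.B₃` —
Theorem 1 and Proposition 7 derived by the induction, Props 2–6, 8, 9, Sect. F verbatim, bridges and `hcrit` displayed, Sect. A and the rest of the dictionary proved —
seat -d's `b11Leaf_Z11OfRecord_of_towerT_parts_kappa_one` minus `hloc`. [cite: Balaban1985Variational, Thm 1 p.279, Sect. A (11)–(14) pp.279–280, Props 2–9 pp.281–309] -/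
theorem b11Leaf_Z11OfRecord_of_towerT_parts_kappa_one_noLoc (ζ : ResidZ F N)
    (β : ∀ i : ZIdx, Bridge (famXOfRecord F N ζ i) (ζ.famLG i)) (bg : ∀ i : ZIdx, GaugeField (F.P i.K) 0 (SU N) → (ζ.famLG i).Cfg)
    {O₁ O₂ e₅ : ℝ}
    (hbg14 : ∀ (i : ZIdx) (ε : ℝ) (V : GaugeField (F.P i.K) i.k (SU N)) (U : GaugeField (F.P i.K) 0 (SU N)),
      InUkClassB11 F N i.K i.k (ζ.C₁ * ζ.B₃ * ε) U → Averaging.iter (avOfRecord F N i.K) i.k U = V →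
        (ζ.famLG i).Sat14 (ζ.C₁ * ζ.B₃ * ε) (ζ.C₁ * ε) ((β i).bdry V) (bg i U))
    (laws : ∀ i, (β i).Laws ζ.C₁ ζ.B₃) (leaves : ∀ i, ExistenceLeavesCap (β i) ζ.B₀ ζ.B₃ ζ.C₁ O₁ O₂ e₅)
    (hcrit : ∀ (i : ZIdx) (e : ℝ) (V : GaugeField (F.P i.K) i.k (SU N)) (U : GaugeField (F.P i.K) 0 (SU N)),
      IsBackground (avOfRecord F N i.K) {U | InUkClassB11 F N i.K i.k e U} i.k V U → ζ.IsCrit i V U)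
    (hB₀ : 0 < ζ.B₀) (hB₁ : 0 < ζ.B₁) (hB₃ : 1 ≤ ζ.B₃) (hC₁L : (F.L : ℝ) ^ 3 ≤ ζ.C₁) (hB₀B₁ : ζ.B₀ ≤ 4 * ζ.B₁)
    (hc₁ : 0 < ζ.c₁) (hO₁ : 0 < O₁) (hO₂ : 0 < O₂) (he₅ : 0 < e₅)
    (p2 : B11.Prop2Printed ζ.B₁ ζ.B₃ ζ.C₁ ζ.c₁ ζ.famLG) (p3 : B11.Prop3Printed ζ.C₁ ζ.B₃ ζ.C₂ ζ.C₃ ζ.B₀ ζ.c1h ζ.c₄ ζ.δ₀ ζ.famLG)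
    (p4 : B11.Prop4Printed ζ.C₁ ζ.B₃ ζ.famLG) (p5 : B11.Prop5Printed ζ.B₁ ζ.B₃ ζ.C₁ ζ.famLG) (p6 : B11.Prop6Printed ζ.B₀ ζ.B₃ ζ.C₁ ζ.famLG)
    (p8 : B11.Prop8Printed ζ.B₃ (famXOfRecord F N ζ)) (sF : B11.SectFPrinted ζ.B₃ (famXOfRecord F N ζ))
    (p9 : B11.Prop9Printed ζ.B₅ ζ.C₁ ζ.β₀ ζ.δ₀ ζ.famAn) :
    B11Leaf (Z11OfRecord F N ζ) :=
  b11Leaf_Z11OfRecord_of_towerT_parts_noLoc ζ β bg (κ₀ := 1) (B₃ := ζ.B₃) hbg14 laws leaves hcrit le_rfl hB₀ hB₁ hB₃ hC₁L hB₀B₁ hc₁ hO₁ hO₂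
    he₅ p2 p5 p6 p8 sF (mul_one _).symm p2 p3 p4 p5 p6 p8 sF p9

end KappaOne

end Summit.QuantumFields.YangMills.BalabanUVNodes.N07AtRecordTwoTierOneSided

end
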